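import Literature.Combinatorics.Optimization.CompletelyPositiveGraphs
import Literature.LinearAlgebra.Matrix.RankMinors
import Mathlib.Analysis.Matrix.PosDef
import Mathlib.Data.Sym.Card
import Mathlib.Combinatorics.SimpleGraph.LapMatrix
import HarnessLib

/-!
# Rank-one `CS_+`-factorizations (`CS_+^{n,1}`), psd Hadamard square roots, and the gap between
# the cpsd-rank and the rank (Prakash–Sikora–Varvitsiotis–Wei 2017, §3.1, §3.2, §3.3.1)

Source: A. Prakash, J. Sikora, A. Varvitsiotis, Z. Wei, *Completely positive semidefinite rank*,
Math. Program. 171 (2018) 397–431 = arXiv:1604.07199 [PrakashEtAl2017]; held text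
`paper:arxiv-1604.07199`, chunks p11 (§3.1 after Lemma 4, §3.2.1, §3.2.2) and p12 (§3.3.1). Companion of
`CompletelyPsdRank.lean` (vocabulary `HasCpsdFactorization`, `IsCpsd`, `IsDnn`, `IsCp`; Lemma 5 is
the named fact `PrakashEtAl2017_lemma5`, discharged there for real symmetric psd matrices) and of
`CompletelyPositiveGraphs.lean` (`IsDnn.isCp_fin_three`: `DNN³ = CP³`). Everything below is PROVED;
no named facts.

## The printed statements (p11–p12, verbatim) and what is typed

* (p11) "We denote by `CS_+^{n,1}` the set of matrices in `CS_+^n` that admit `CS_+`-factorizations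
  using rank-one factors. Furthermore, we call a Hadamard square root of `X ∈ ℝ^{n×m}_+` any matrix
  obtained by replacing each entry of `X` by one of its two square roots. … **Lemma 5.** For any
  matrix `X ∈ H^n_+` we have that `X ∘ X̄ ∈ CS_+^{n,1}` and moreover `cpsd-rank(X ∘ X̄) ≤ rank(X)`. …
  Conversely, if `X ∈ CS_+^{n,1}` then `X` has a psd Hadamard square root."
  Typed: `HasRankOneCpsdFactorization X d` (= "`X ∈ CS_+^{n,1}` with rank-one factors of size `d`");
  the bridge `hasRankOneCpsdFactorization_hadamard_self` to the tree's discharged Lemma 5 (real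
  symmetric psd `X`, size `rank X`); Lemma 5's first half for COMPLEX Hermitian psd `G`
  (`hasRankOneCpsdFactorization_of_posSemidef_normSq_eq`: `G ∘ Ḡ ∈ CS_+^{n,1}` with factors of size
  `n` — TODO(general form): size `rank G`, as in the real case of `CompletelyPsdRank.lean`); and the
  converse half in the form its (omitted, "straightforward") proof gives: rank-one factors
  `P_i = x_i x_i^*` make `X_{ij} = |x_i^* x_j|²`, so the Gram matrix `G = (x_i^* x_j)_{ij} ∈ H^n_+`
  satisfies `G ∘ Ḡ = X` (`HasRankOneCpsdFactorization.exists_posSemidef_normSq_eq`): `X` has a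
  COMPLEX Hermitian psd "Hadamard square root" `G`, `|G_{ij}|² = X_{ij}`. (The Gram matrix is complex
  in general; the printed sentence speaks of real `±√X_{ij}` square roots. The characterisation
  `exists_hasRankOneCpsdFactorization_iff` is stated with complex `G`, which is what both halves of
  the proof give, and a real psd Hadamard square root is a special case:
  `hasRankOneCpsdFactorization_of_sq_eq`.)
* (p11) "As a concrete example of a matrix in `CS_+ \ CS_+^{1}`, consider
  `X = [1 √2/2 √2/2; √2/2 1 1/10; √2/2 1/10 1]`. Clearly `X ∈ CS_+^3 = DNN^3`, but no Hadamard
  square root of `X` is psd." Typed and PROVED as `PrakashEtAl2017_example_cpsd_not_rankOne`: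
  `IsCpsd X` (via `DNN³ = CP³ ⊆ CS_+³`) and `∀ d, ¬ HasRankOneCpsdFactorization X d`; the obstruction
  is proved for every COMPLEX Hermitian psd `G` with `|G_{ij}|² = X_{ij}` (`det G < 0` whatever the
  phases: `det G = 1 − 1/10 − √2 + 2 Re(G₀₁G₁₂Ḡ₀₂)` and `|G₀₁G₁₂Ḡ₀₂|² = 1/20`), which covers the
  real `±` square roots (`psvwNoRankOneMatrix_no_real_psd_sqrt`).
* (p11, after Theorem 3) "the Cauchy–Schwartz inequality combined with the fact that any cpsd
  matrix is entrywise nonnegative implies that the lower bound (6) can never exceed the size of the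
  matrix": `PrakashEtAl2017_thm3_bound_le_size` (`(Σ_i √X_ii)² ≤ n · Σ_{ij} X_ij` for entrywise
  nonnegative `X`).
* (p11, §3.2.2) "By Theorem 4 and the fact that `f(G)` is upper bounded by `n` it follows that
  support-based lower bounds on the cpsd-rank never exceed the size of the matrix" (appended
  2026-08-28): `exists_support_eq_hasRankOneCpsdFactorization_card` (the Hadamard square of the graph
  Laplacian: support `G`, rank-one factors of size `n`) and, through the tree's discharged Theorem 4,
  `PrakashEtAl2017_supportBound_le_size` (`f(G) ≤ n`: subspaces `L_i ⊆ ℂ^n` with `L_i ⊥ L_j ⟺ i ≁ j`).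
* (p12, §3.3.1) "As `H^d` is isometrically isomorphic to `ℝ^{d²}`, we have `√rank(X) ≤ cpsd-rank(X)`
  [the tree's `PrakashEtAl2017_rank_le_cpsdRank_sq`] … We provide an example that illustrates that
  the above can be tight up to a constant factor. Let `r ≥ 2` be an integer and let
  `E_{i,j} := I_r + e_ie_jᵀ + e_je_iᵀ ∈ H^r_+` for all `i,j ∈ [r]`. The matrix
  `X := Gram({E_{i,j}}_{i,j}) ∈ CS_+^{r(r−1)/2}` has `cpsd-rank(X) ≤ r`, by construction, while `X`
  can be easily seen to have full rank." Typed and PROVED: with the unordered pairs `{i,j}`, `i ≠ j`,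
  as index set (`OffDiagPair r`, of cardinality `r.choose 2 = r(r−1)/2`), `E_{ij} = pairOneMatrix`,
  the Gram matrix is computed in closed form, `Tr(E_a E_b) = r + 2·[a = b]`, i.e. `X = r·J + 2·I`
  (`pairGramMatrix`, `trace_pairOneMatrix_mul`); `hasCpsdFactorization_pairGramMatrix`
  (`cpsd-rank ≤ r`), `pairGramMatrix_posDef`, `rank_pairGramMatrix` (`rank X = r.choose 2`), summarised
  in `PrakashEtAl2017_rank_vs_cpsdRank_example`.
-/

noncomputable section

open Matrix Finset
open scoped MatrixOrder ComplexOrder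

namespace Literature.Combinatorics.Optimization

variable {ι : Type*} [Fintype ι]

/-! ### `CS_+^{n,1}`: `CS_+`-factorizations by rank-one factors -/

/-- **`X ∈ CS_+^{n,1}` with factors of size `d`** (p11, verbatim: "the set of matrices in `CS_+^n`
that admit `CS_+`-factorizations using rank-one factors"): Hermitian psd `P_1,…,P_n ∈ H^d_+` of rank
`≤ 1` with `X_{ij} = Tr(P_i P_j)` (rank `≤ 1` rather than `= 1`, so that zero rows are allowed, as in
the tree's typing of Lemma 5). [cite: PrakashEtAl2017, §3.1 (p11)] -/
def HasRankOneCpsdFactorization (X : Matrix ι ι ℝ) (d : ℕ) : Prop :=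
  ∃ P : ι → Matrix (Fin d) (Fin d) ℂ, (∀ i, (P i).PosSemidef ∧ (P i).rank ≤ 1) ∧
    ∀ i j, ((X i j : ℝ) : ℂ) = (P i * P j).trace

omit [Fintype ι] in
/-- A rank-one `CS_+`-factorization is a `CS_+`-factorization (`CS_+^{n,1} ⊆ CS_+^n`).
[cite: PrakashEtAl2017, §3.1 (p11)] -/
theorem HasRankOneCpsdFactorization.hasCpsdFactorization {X : Matrix ι ι ℝ} {d : ℕ}
    (h : HasRankOneCpsdFactorization X d) : HasCpsdFactorization X d := by
  obtain ⟨P, hP, hX⟩ := h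
  exact ⟨P, fun i => (hP i).1, hX⟩

omit [Fintype ι] in
/-- `CS_+^{n,1} ⊆ CS_+^n`. [cite: PrakashEtAl2017, §3.1 (p11)] -/
theorem HasRankOneCpsdFactorization.isCpsd {X : Matrix ι ι ℝ} {d : ℕ}
    (h : HasRankOneCpsdFactorization X d) : IsCpsd X :=
  ⟨d, h.hasCpsdFactorization⟩

/-- **Lemma 5, first half, in this vocabulary** (the tree's discharged named fact
`PrakashEtAl2017_lemma5`): for a real psd `X`, the Hadamard square `X ∘ X` lies in `CS_+^{n,1}` with
rank-one factors of size `rank X`. [cite: PrakashEtAl2017, Lemma 5 (p11)] -/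
theorem hasRankOneCpsdFactorization_hadamard_self {ι : Type} [Fintype ι] (X : Matrix ι ι ℝ)
    (hX : X.PosSemidef) : HasRankOneCpsdFactorization (X ⊙ X) X.rank := by
  obtain ⟨P, hP, hfac⟩ := (PrakashEtAl2017_lemma5_holds ι X hX).1
  refine ⟨P, hP, fun i j => ?_⟩
  rw [hadamard_apply, ← sq]
  exact hfac i j

/-- A Hermitian psd complex matrix of rank `≤ 1` is `v v^*` (if `X ≠ 0`, some diagonal entry
`X_tt > 0` and `X = X e_t (X e_t)^* / X_tt` by the vanishing `2 × 2` minors; private copy of the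
lemma of the same name in `ComplexPsdMinimalPolytopes.lean`). [folklore] -/
private theorem eq_vecMulVec_of_posSemidef_rank_le_one {k : ℕ} {X : Matrix (Fin k) (Fin k) ℂ}
    (hX : X.PosSemidef) (hr : X.rank ≤ 1) : ∃ v : Fin k → ℂ, X = vecMulVec v (star v) := by
  classical
  by_cases h0 : X = 0
  · exact ⟨0, by rw [h0]; ext s t; simp [vecMulVec_apply]⟩
  -- a nonzero diagonal entry
  obtain ⟨C, hC⟩ := CStarAlgebra.nonneg_iff_eq_star_mul_self.mp hX.nonneg
  have hXC : X = Cᴴ * C := by rw [hC, star_eq_conjTranspose]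
  have hdiag : ∃ t, X t t ≠ 0 := by
    by_contra hall
    push Not at hall
    apply h0
    -- every column of `C` vanishes
    have hcol : ∀ t l, C l t = 0 := fun t l => by
      have h1 : X t t = ∑ l, star (C l t) * C l t := by
        rw [hXC, Matrix.mul_apply]; rfl
      have h2 : ∑ l, star (C l t) * C l t = ∑ l, ((Complex.normSq (C l t) : ℝ) : ℂ) :=
        Finset.sum_congr rfl fun l _ => by rw [Complex.star_def, Complex.normSq_eq_conj_mul_self]
      have h3 : ∑ l, Complex.normSq (C l t) = 0 := by
        have := hall t
        rw [h1, h2] at this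
        exact_mod_cast this
      have h4 := (Finset.sum_eq_zero_iff_of_nonneg fun l _ => Complex.normSq_nonneg (C l t)).mp h3 l
        (Finset.mem_univ l)
      exact Complex.normSq_eq_zero.mp h4
    ext s u
    rw [hXC, Matrix.mul_apply]
    simp [hcol]
  obtain ⟨t, ht⟩ := hdiag
  -- `X_tt` is a positive real
  have httre : X t t = ((X t t).re : ℂ) := by
    have h := hX.1.apply t t
    rw [Complex.ext_iff]
    refine ⟨by simp, ?_⟩
    have : (X t t).im = -(X t t).im := by
      conv_lhs => rw [← h]
      simp
    simp only [Complex.ofReal_im]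
    linarith
  have htpos : 0 < (X t t).re := by
    have h' : 0 ≤ X t t := hX.diag_nonneg
    rcases (Complex.nonneg_iff.mp h').1.eq_or_lt with h1 | h1
    · exfalso; apply ht; rw [httre, ← h1]; simp
    · exact h1
  -- the `2 × 2` minors through `(t,t)` vanish
  have hminor : ∀ s u, X s u * X t t = X s t * X t u := fun s u => by
    have h := Literature.LinearAlgebra.Matrix.det_submatrix_eq_zero_of_rank_lt_card X ![s, t] ![u, t]
      (by simp; omega)
    rw [Matrix.det_fin_two] at h
    simp at h
    linear_combination h
  set r : ℝ := Real.sqrt (X t t).re with hr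
  have hr0 : (r : ℂ) ≠ 0 := by
    rw [Ne, Complex.ofReal_eq_zero, hr]
    exact (Real.sqrt_pos.mpr htpos).ne'
  have hrr : (r : ℂ) * r = X t t := by
    rw [httre, ← Complex.ofReal_mul, hr, Real.mul_self_sqrt htpos.le]
  refine ⟨fun s => X s t / r, ?_⟩
  ext s u
  simp only [vecMulVec_apply, Pi.star_apply, star_div₀, Complex.star_def, Complex.conj_ofReal]
  have hconj : (starRingEnd ℂ) (X u t) = X t u := by
    have := hX.1.apply t u
    rwa [Complex.star_def] at this
  rw [hconj]
  field_simp
  rw [sq, hrr]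
  linear_combination hminor s u

/-- `Tr(aa^* · bb^*) = |a^*b|²` (private copy of the `ComplexPsdMinimalPolytopes.lean` lemma).
[folklore] -/
private theorem trace_vecMulVec_mul_vecMulVec' {k : ℕ} (a b : Fin k → ℂ) :
    (vecMulVec a (star a) * vecMulVec b (star b)).trace =
      ((Complex.normSq (star a ⬝ᵥ b) : ℝ) : ℂ) := by
  rw [← Complex.mul_conj]
  simp only [trace, diag_apply, mul_apply, vecMulVec_apply, dotProduct, Pi.star_apply,
    Complex.star_def, map_sum, map_mul, Complex.conj_conj, Finset.sum_mul_sum]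
  rw [Finset.sum_comm]
  exact Finset.sum_congr rfl fun s _ => Finset.sum_congr rfl fun t _ => by ring

omit [Fintype ι] in
/-- Rank-one factors are outer products `P_i = x_i x_i^*`, whence `X_{ij} = Tr(P_i P_j) = |x_i^* x_j|²`
(the Gram vectors of a rank-one `CS_+`-factorization). [cite: PrakashEtAl2017, Lemma 5 (p11)] -/
theorem HasRankOneCpsdFactorization.exists_normSq_dotProduct {X : Matrix ι ι ℝ} {d : ℕ}
    (h : HasRankOneCpsdFactorization X d) :
    ∃ x : ι → Fin d → ℂ, ∀ i j, X i j = Complex.normSq (star (x i) ⬝ᵥ x j) := by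
  classical
  obtain ⟨P, hP, hX⟩ := h
  choose x hx using fun i => eq_vecMulVec_of_posSemidef_rank_le_one (hP i).1 (hP i).2
  refine ⟨x, fun i j => ?_⟩
  have h1 := hX i j
  rw [hx i, hx j, trace_vecMulVec_mul_vecMulVec'] at h1
  exact_mod_cast h1

/-- **PSVW Lemma 5, converse half** (p11: "Conversely, if `X ∈ CS_+^{n,1}` then `X` has a psd
Hadamard square root"), in the form the proof gives: the Gram matrix `G = (x_i^* x_j)_{ij}` of the
vectors of the rank-one factors is a (complex, Hermitian) psd matrix with `|G_{ij}|² = X_{ij}`, i.e.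
`G ∘ Ḡ = X`. [cite: PrakashEtAl2017, Lemma 5 (p11)] -/
theorem HasRankOneCpsdFactorization.exists_posSemidef_normSq_eq {X : Matrix ι ι ℝ} {d : ℕ}
    (h : HasRankOneCpsdFactorization X d) :
    ∃ G : Matrix ι ι ℂ, G.PosSemidef ∧ ∀ i j, X i j = Complex.normSq (G i j) := by
  obtain ⟨x, hx⟩ := h.exists_normSq_dotProduct
  -- `G = Bᴴ B` for the `d × n` matrix `B` with columns `x_i`
  let B : Matrix (Fin d) ι ℂ := Matrix.of fun k i => x i k
  refine ⟨Bᴴ * B, posSemidef_conjTranspose_mul_self B, fun i j => ?_⟩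
  rw [hx i j]
  congr 1

/-- **PSVW Lemma 5, first half, for a complex Hermitian psd matrix `G ∈ H^n_+`**: `G ∘ Ḡ`, the
matrix `(|G_{ij}|²)`, lies in `CS_+^{n,1}` — with `G = C^*C`, the columns `c_i ∈ ℂ^n` of `C` give
rank-one factors `P_i = c_i c_i^*` with `Tr(P_i P_j) = |c_i^* c_j|² = |G_{ij}|²`. Factors of size
`n` here (TODO(general form): size `rank G`, cf. the real case `PrakashEtAl2017_lemma5_holds`).
[cite: PrakashEtAl2017, Lemma 5 (p11)] -/
theorem hasRankOneCpsdFactorization_of_posSemidef_normSq_eq {G : Matrix ι ι ℂ}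
    (hG : G.PosSemidef) {X : Matrix ι ι ℝ} (hX : ∀ i j, X i j = Complex.normSq (G i j)) :
    HasRankOneCpsdFactorization X (Fintype.card ι) := by
  classical
  obtain ⟨C, hC⟩ := CStarAlgebra.nonneg_iff_eq_star_mul_self.mp hG.nonneg
  let e := Fintype.equivFin ι
  let x : ι → Fin (Fintype.card ι) → ℂ := fun i k => C (e.symm k) i
  refine ⟨fun i => vecMulVec (x i) (star (x i)),
    fun i => ⟨posSemidef_vecMulVec_self_star _, rank_vecMulVec_le _ _⟩, fun i j => ?_⟩
  rw [trace_vecMulVec_mul_vecMulVec', hX i j]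
  congr 2
  rw [hC, star_eq_conjTranspose, Matrix.mul_apply, dotProduct]
  simp only [conjTranspose_apply, Pi.star_apply, x]
  exact (Equiv.sum_comp e.symm (fun k => star (C k i) * C k j)).symm

/-- A REAL psd Hadamard square root `H` of `X` (`H ⪰ 0`, `H_{ij}² = X_{ij}`) puts `X` in `CS_+^{n,1}`
(the real special case of the previous statement). [cite: PrakashEtAl2017, Lemma 5 (p11)] -/
theorem hasRankOneCpsdFactorization_of_sq_eq {H : Matrix ι ι ℝ} (hH : H.PosSemidef)
    {X : Matrix ι ι ℝ} (hX : ∀ i j, X i j = H i j ^ 2) :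
    HasRankOneCpsdFactorization X (Fintype.card ι) := by
  classical
  -- `H = BᵀB`, so `H.map ofReal = (B.map ofReal)ᴴ (B.map ofReal)` is a complex psd matrix
  obtain ⟨B, hB⟩ := CStarAlgebra.nonneg_iff_eq_star_mul_self.mp hH.nonneg
  have hBT : star B = Bᵀ := by
    rw [star_eq_conjTranspose, conjTranspose_eq_transpose_of_trivial]
  let B' : Matrix ι ι ℂ := B.map Complex.ofReal
  have hG : (B'ᴴ * B').PosSemidef := posSemidef_conjTranspose_mul_self B'
  refine hasRankOneCpsdFactorization_of_posSemidef_normSq_eq hG fun i j => ?_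
  have hentry : (B'ᴴ * B') i j = ((H i j : ℝ) : ℂ) := by
    rw [hB, hBT, Matrix.mul_apply, Matrix.mul_apply]
    push_cast
    simp only [conjTranspose_apply, transpose_apply, B', Matrix.map_apply, Complex.star_def,
      Complex.conj_ofReal]
  rw [hentry, Complex.normSq_ofReal, hX i j, sq]

/-- **`CS_+^{n,1}` = matrices with a psd (complex, modulus) Hadamard square root**: `X ∈ CS_+^{n,1}`
(rank-one factors of some size) iff `X_{ij} = |G_{ij}|²` for some `G ∈ H^n_+` — both halves of
Lemma 5's proof. [cite: PrakashEtAl2017, Lemma 5 (p11)] -/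
theorem exists_hasRankOneCpsdFactorization_iff {X : Matrix ι ι ℝ} :
    (∃ d, HasRankOneCpsdFactorization X d) ↔
      ∃ G : Matrix ι ι ℂ, G.PosSemidef ∧ ∀ i j, X i j = Complex.normSq (G i j) :=
  ⟨fun ⟨_, h⟩ => h.exists_posSemidef_normSq_eq,
    fun ⟨_, hG, hX⟩ => ⟨_, hasRankOneCpsdFactorization_of_posSemidef_normSq_eq hG hX⟩⟩

/-- Consequently rank-one factors can always be taken of size `n`: `X ∈ CS_+^{n,1}` with factors of
any size `d` has rank-one factors of size `n`. [cite: PrakashEtAl2017, Lemma 5 (p11)] -/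
theorem HasRankOneCpsdFactorization.card {X : Matrix ι ι ℝ} {d : ℕ}
    (h : HasRankOneCpsdFactorization X d) : HasRankOneCpsdFactorization X (Fintype.card ι) := by
  obtain ⟨G, hG, hX⟩ := h.exists_posSemidef_normSq_eq
  exact hasRankOneCpsdFactorization_of_posSemidef_normSq_eq hG hX

/-! ### The example `X ∈ CS_+^3 \ CS_+^{3,1}` (p11) -/

/-- The printed matrix `X = [1 √2/2 √2/2; √2/2 1 1/10; √2/2 1/10 1]` (p11).
[cite: PrakashEtAl2017, §3.1 (p11)] -/
def psvwNoRankOneMatrix : Matrix (Fin 3) (Fin 3) ℝ :=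
  !![1, Real.sqrt 2 / 2, Real.sqrt 2 / 2;
     Real.sqrt 2 / 2, 1, 1 / 10;
     Real.sqrt 2 / 2, 1 / 10, 1]

/-- A Cholesky factor: `X = L Lᵀ` with `L = [1 0 0; √2/2 √2/2 0; √2/2 −2√2/5 3√2/10]`.
[cite: PrakashEtAl2017, §3.1 (p11), "Clearly `X ∈ CS_+^3 = DNN^3`"] -/
def psvwNoRankOneCholesky : Matrix (Fin 3) (Fin 3) ℝ :=
  !![1, 0, 0;
     Real.sqrt 2 / 2, Real.sqrt 2 / 2, 0;
     Real.sqrt 2 / 2, -(2 * Real.sqrt 2 / 5), 3 * Real.sqrt 2 / 10]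

/-- `X = L Lᵀ`. [cite: PrakashEtAl2017, §3.1 (p11)] -/
theorem psvwNoRankOneMatrix_eq_mul_transpose :
    psvwNoRankOneMatrix = psvwNoRankOneCholesky * psvwNoRankOneCholeskyᵀ := by
  have hs : Real.sqrt 2 * Real.sqrt 2 = 2 := Real.mul_self_sqrt (by norm_num)
  ext i j
  fin_cases i <;> fin_cases j <;>
    simp [psvwNoRankOneMatrix, psvwNoRankOneCholesky, Matrix.mul_apply, Fin.sum_univ_three] <;>
    nlinarith [hs]

/-- `X` is psd ("Clearly `X ∈ … DNN^3`"). [cite: PrakashEtAl2017, §3.1 (p11)] -/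
theorem psvwNoRankOneMatrix_posSemidef : psvwNoRankOneMatrix.PosSemidef := by
  rw [psvwNoRankOneMatrix_eq_mul_transpose, ← conjTranspose_eq_transpose_of_trivial]
  exact posSemidef_self_mul_conjTranspose _

/-- `X` is entrywise nonnegative. [cite: PrakashEtAl2017, §3.1 (p11)] -/
theorem psvwNoRankOneMatrix_nonneg (i j : Fin 3) : 0 ≤ psvwNoRankOneMatrix i j := by
  fin_cases i <;> fin_cases j <;> simp [psvwNoRankOneMatrix] <;> positivity

/-- `X ∈ DNN^3`. [cite: PrakashEtAl2017, §3.1 (p11)] -/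
theorem psvwNoRankOneMatrix_isDnn : IsDnn psvwNoRankOneMatrix :=
  ⟨psvwNoRankOneMatrix_posSemidef, psvwNoRankOneMatrix_nonneg⟩

/-- `X ∈ CS_+^3` ("`X ∈ CS_+^3 = DNN^3`": through `DNN³ = CP³ ⊆ CS_+³`, the tree's
`IsDnn.isCp_fin_three`). [cite: PrakashEtAl2017, §3.1 (p11)] -/
theorem psvwNoRankOneMatrix_isCpsd : IsCpsd psvwNoRankOneMatrix :=
  psvwNoRankOneMatrix_isDnn.isCp_fin_three.isCpsd

/-- **No complex Hermitian psd `G` has `|G_{ij}|² = X_{ij}`** ("no Hadamard square root of `X` is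
psd", proved for all phases at once): such a `G` has unit diagonal, `|G₀₁|² = |G₀₂|² = √2/2`,
`|G₁₂|² = 1/10`, and `0 ≤ det G = 1 − 1/10 − √2 + 2 Re z` with `z = G₀₁G₁₂Ḡ₀₂`, `|z|² = 1/20` —
impossible since `(√2 − 9/10)²/4 > 1/20`. [cite: PrakashEtAl2017, §3.1 (p11)] -/
theorem psvwNoRankOneMatrix_no_psd_modulus_sqrt (G : Matrix (Fin 3) (Fin 3) ℂ) (hG : G.PosSemidef)
    (hX : ∀ i j, psvwNoRankOneMatrix i j = Complex.normSq (G i j)) : False := by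
  set s : ℝ := Real.sqrt 2 with hs_def
  have hs2 : s * s = 2 := Real.mul_self_sqrt (by norm_num)
  have hs_gt : (1.41 : ℝ) < s := by
    rw [hs_def, Real.lt_sqrt (by norm_num)]; norm_num
  have hs_lt : s < 1.42 := by
    rw [hs_def, Real.sqrt_lt' (by norm_num)]; norm_num
  have hherm : ∀ i j, star (G j i) = G i j := fun i j => hG.1.apply i j
  -- the moduli of the entries
  have h01 : Complex.normSq (G 0 1) = s / 2 := by
    rw [← hX 0 1]; simp [psvwNoRankOneMatrix, hs_def]
  have h02 : Complex.normSq (G 0 2) = s / 2 := by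
    rw [← hX 0 2]; simp [psvwNoRankOneMatrix, hs_def]
  have h12 : Complex.normSq (G 1 2) = 1 / 10 := by
    rw [← hX 1 2]; simp [psvwNoRankOneMatrix]
  -- unit diagonal: `G_ii ≥ 0` and `|G_ii|² = 1`
  have hdiag : ∀ i, G i i = 1 := by
    intro i
    have h0 : (0 : ℂ) ≤ G i i := hG.diag_nonneg
    obtain ⟨hre, him⟩ := Complex.nonneg_iff.mp h0
    have h1 : Complex.normSq (G i i) = 1 := by
      rw [← hX i i]; fin_cases i <;> simp [psvwNoRankOneMatrix]
    rw [Complex.normSq_apply, ← him] at h1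
    apply Complex.ext
    · simp only [Complex.one_re]
      nlinarith [hre, h1]
    · simp [← him]
  -- the determinant
  have hdet : (0 : ℂ) ≤ G.det := hG.det_nonneg
  rw [Matrix.det_fin_three] at hdet
  set p := G 0 1 with hp
  set q := G 0 2 with hq
  set w := G 1 2 with hw
  have h10 : G 1 0 = star p := (hherm 1 0).symm
  have h20 : G 2 0 = star q := (hherm 2 0).symm
  have h21 : G 2 1 = star w := (hherm 2 1).symm
  rw [hdiag 0, hdiag 1, hdiag 2, h10, h20, h21] at hdet
  set z : ℂ := p * w * star q with hz
  have key : (1 * 1 * 1 - 1 * w * star w - p * star p * 1 + p * w * star q + q * star p * star w -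
      q * 1 * star q : ℂ) =
      ((1 - Complex.normSq w - Complex.normSq p - Complex.normSq q + 2 * z.re : ℝ) : ℂ) := by
    apply Complex.ext
    · simp only [hz, Complex.sub_re, Complex.add_re, Complex.mul_re, Complex.mul_im, Complex.one_re,
        Complex.one_im, Complex.star_def, Complex.conj_re, Complex.conj_im, Complex.ofReal_re,
        Complex.normSq_apply]
      ring
    · simp only [hz, Complex.sub_im, Complex.add_im, Complex.mul_re, Complex.mul_im, Complex.one_re,
        Complex.one_im, Complex.star_def, Complex.conj_re, Complex.conj_im, Complex.ofReal_im,
        Complex.normSq_apply]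
      ring
  rw [key, Complex.zero_le_real, h01, h02, h12] at hdet
  -- `(Re z)² ≤ |z|² = |p|²|w|²|q|² = 1/20`
  have hzsq : Complex.normSq z = 1 / 20 := by
    rw [hz, Complex.normSq_mul, Complex.normSq_mul, Complex.star_def, Complex.normSq_conj, h01, h12,
      h02]
    nlinarith [hs2]
  have hre : z.re * z.re ≤ 1 / 20 := by
    rw [← hzsq, Complex.normSq_apply]
    nlinarith [mul_self_nonneg z.im]
  have hs09 : 0 ≤ s - 0.9 := by linarith
  have hR : 0 ≤ z.re := by nlinarith
  nlinarith [mul_nonneg hdet hs09, mul_nonneg hdet hR, hre, hs2, hs_lt, hs_gt]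

/-- In particular no REAL Hadamard square root `H` (`H_{ij} = ±√X_{ij}`) of `X` is psd — the printed
claim. [cite: PrakashEtAl2017, §3.1 (p11)] -/
theorem psvwNoRankOneMatrix_no_real_psd_sqrt (H : Matrix (Fin 3) (Fin 3) ℝ)
    (hH : ∀ i j, H i j ^ 2 = psvwNoRankOneMatrix i j) : ¬ H.PosSemidef := by
  intro hpsd
  obtain ⟨G, hG, hX⟩ :=
    (hasRankOneCpsdFactorization_of_sq_eq hpsd fun i j => (hH i j).symm).exists_posSemidef_normSq_eq
  exact psvwNoRankOneMatrix_no_psd_modulus_sqrt G hG hX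

/-- `X ∉ CS_+^{3,1}`: `X` has no `CS_+`-factorization by rank-one factors, of any size.
[cite: PrakashEtAl2017, §3.1 (p11)] -/
theorem psvwNoRankOneMatrix_not_hasRankOneCpsdFactorization (d : ℕ) :
    ¬ HasRankOneCpsdFactorization psvwNoRankOneMatrix d := by
  intro h
  obtain ⟨G, hG, hX⟩ := h.exists_posSemidef_normSq_eq
  exact psvwNoRankOneMatrix_no_psd_modulus_sqrt G hG hX

/-- **PSVW §3.1, "a concrete example of a matrix in `CS_+ \ CS_+^{1}`"** (p11): the printed `X` is
completely positive semidefinite but admits no `CS_+`-factorization using only rank-one factors.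
[cite: PrakashEtAl2017, §3.1 (p11)] -/
theorem PrakashEtAl2017_example_cpsd_not_rankOne :
    IsCpsd psvwNoRankOneMatrix ∧ ∀ d, ¬ HasRankOneCpsdFactorization psvwNoRankOneMatrix d :=
  ⟨psvwNoRankOneMatrix_isCpsd, psvwNoRankOneMatrix_not_hasRankOneCpsdFactorization⟩

/-! ### §3.2.1, remark after Theorem 3: the analytic bound never exceeds the size -/

/-- **The analytic lower bound is at most `n`** (p11, verbatim: "the Cauchy–Schwartz inequality
combined with the fact that any cpsd matrix is entrywise nonnegative implies that the lower bound (6)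
can never exceed the size of the matrix"): for an entrywise nonnegative `X`,
`(Σ_i √X_ii)² ≤ n · Σ_{i,j} X_ij` (so `(Σ√X_ii)²/Σ X_ij ≤ n`). [cite: PrakashEtAl2017, §3.2.1 (p11)] -/
theorem PrakashEtAl2017_thm3_bound_le_size (X : Matrix ι ι ℝ) (hX : ∀ i j, 0 ≤ X i j) :
    (∑ i, Real.sqrt (X i i)) ^ 2 ≤ Fintype.card ι * ∑ i, ∑ j, X i j := by
  classical
  -- Cauchy–Schwarz: `(Σ 1·√X_ii)² ≤ (Σ 1²)(Σ X_ii)`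
  have hcs := Finset.sum_mul_sq_le_sq_mul_sq (Finset.univ : Finset ι) (fun _ => (1 : ℝ))
    (fun i => Real.sqrt (X i i))
  simp only [one_mul, one_pow, Finset.sum_const, Finset.card_univ, nsmul_eq_mul, mul_one] at hcs
  have hsq : ∀ i, Real.sqrt (X i i) ^ 2 = X i i := fun i => Real.sq_sqrt (hX i i)
  simp only [hsq] at hcs
  -- `Σ_i X_ii ≤ Σ_{i,j} X_ij`
  have hdiag : ∑ i, X i i ≤ ∑ i, ∑ j, X i j :=
    Finset.sum_le_sum fun i _ =>
      Finset.single_le_sum (f := fun j => X i j) (fun j _ => hX i j) (Finset.mem_univ i)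
  calc (∑ i, Real.sqrt (X i i)) ^ 2 ≤ Fintype.card ι * ∑ i, X i i := hcs
    _ ≤ Fintype.card ι * ∑ i, ∑ j, X i j :=
        mul_le_mul_of_nonneg_left hdiag (Nat.cast_nonneg _)

/-- For a cpsd matrix (entrywise nonnegative by `IsCpsd.isDnn`) the analytic bound of Theorem 3 is
at most the size `n`. [cite: PrakashEtAl2017, §3.2.1 (p11)] -/
theorem IsCpsd.thm3_bound_le_size {X : Matrix ι ι ℝ} (h : IsCpsd X) :
    (∑ i, Real.sqrt (X i i)) ^ 2 ≤ Fintype.card ι * ∑ i, ∑ j, X i j :=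
  PrakashEtAl2017_thm3_bound_le_size X h.isDnn.2

/-! ### §3.3.1: `√rank X ≤ cpsd-rank X` is tight up to a constant — `X = Gram{E_{ij}}` -/

/-- The index set of the example: unordered pairs `{i,j} ⊆ [r]`, `i ≠ j` (non-diagonal elements of
`Sym2 (Fin r)`), of cardinality `r(r−1)/2`. [cite: PrakashEtAl2017, §3.3.1 (p12)] -/
abbrev OffDiagPair (r : ℕ) : Type := {a : Sym2 (Fin r) // ¬a.IsDiag}

/-- `|{ {i,j} : i ≠ j }| = r.choose 2 = r(r−1)/2`. [cite: PrakashEtAl2017, §3.3.1 (p12)] -/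
theorem card_offDiagPair (r : ℕ) : Fintype.card (OffDiagPair r) = r.choose 2 := by
  rw [Sym2.card_subtype_not_diag, Fintype.card_fin]

/-- `E_a := I_r + e_ie_jᵀ + e_je_iᵀ ∈ H^r_+` for the unordered pair `a = {i,j}` (p12), as a complex
matrix: the identity plus the `0/1` matrix supported on the two positions `(i,j)`, `(j,i)`.
[cite: PrakashEtAl2017, §3.3.1 (p12)] -/
def pairOneMatrix (r : ℕ) (a : Sym2 (Fin r)) : Matrix (Fin r) (Fin r) ℂ :=
  1 + Matrix.of fun k l => if s(k, l) = a then 1 else 0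

/-- The indicator of `{(k,l) : {k,l} = {i,j}}` splits as `[k=i, l=j] + [k=j, l=i]` when `i ≠ j`.
[cite: PrakashEtAl2017, §3.3.1 (p12)] -/
private theorem ite_mk_eq_mk {r : ℕ} {i j : Fin r} (hij : i ≠ j) (k l : Fin r) :
    (if s(k, l) = s(i, j) then (1 : ℂ) else 0) =
      (if l = j then (if k = i then 1 else 0) else 0) +
        (if l = i then (if k = j then 1 else 0) else 0) := by
  simp only [Sym2.eq_iff]
  by_cases hki : k = i <;> by_cases hkj : k = j <;> by_cases hli : l = i <;> by_cases hlj : l = j <;>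
    simp_all

/-- `Σ_{k,l} [ {k,l} = {i,j} ] = 2` for `i ≠ j` (the two orderings). [cite: PrakashEtAl2017, §3.3.1 (p12)] -/
private theorem sum_sum_ite_mk_eq_mk {r : ℕ} {i j : Fin r} (hij : i ≠ j) :
    ∑ k, ∑ l, (if s(k, l) = s(i, j) then (1 : ℂ) else 0) = 2 := by
  simp_rw [ite_mk_eq_mk hij, Finset.sum_add_distrib, Finset.sum_ite_eq', Finset.mem_univ, if_true]
  norm_num

/-- `E_{ij} = (e_i + e_j)(e_i + e_j)ᵀ + diag(𝟙_{k ∉ {i,j}})`, a sum of two psd matrices.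
[cite: PrakashEtAl2017, §3.3.1 (p12), "`E_{i,j} ∈ H^r_+`"] -/
private theorem pairOneMatrix_eq_add {r : ℕ} {i j : Fin r} (hij : i ≠ j) :
    pairOneMatrix r s(i, j) =
      vecMulVec (fun k => if k = i ∨ k = j then (1 : ℂ) else 0)
          (star fun k => if k = i ∨ k = j then (1 : ℂ) else 0) +
        Matrix.diagonal fun k => if k = i ∨ k = j then (0 : ℂ) else 1 := by
  ext k l
  simp only [pairOneMatrix, Matrix.add_apply, Matrix.one_apply, Matrix.of_apply, vecMulVec_apply,
    Pi.star_apply, diagonal_apply, Sym2.eq_iff]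
  by_cases hki : k = i <;> by_cases hkj : k = j <;> by_cases hli : l = i <;> by_cases hlj : l = j <;>
    simp_all <;> (rintro rfl; simp_all)

/-- `E_{ij} ∈ H^r_+` (p12): `E_{ij}` is (Hermitian) psd. [cite: PrakashEtAl2017, §3.3.1 (p12)] -/
theorem pairOneMatrix_posSemidef {r : ℕ} {i j : Fin r} (hij : i ≠ j) :
    (pairOneMatrix r s(i, j)).PosSemidef := by
  rw [pairOneMatrix_eq_add hij]
  refine (posSemidef_vecMulVec_self_star _).add (PosSemidef.diagonal fun k => ?_)
  by_cases h : k = i ∨ k = j <;> simp [h]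

/-- Every non-diagonal unordered pair's matrix `E_a` is psd. [cite: PrakashEtAl2017, §3.3.1 (p12)] -/
theorem pairOneMatrix_posSemidef_of_not_isDiag {r : ℕ} {a : Sym2 (Fin r)} (ha : ¬a.IsDiag) :
    (pairOneMatrix r a).PosSemidef := by
  induction a using Sym2.ind with
  | h i j => exact pairOneMatrix_posSemidef (by rwa [Sym2.mk_isDiag_iff] at ha)

/-- **The Gram matrix of the `E_a` in closed form**: `Tr(E_a E_b) = r + 2·[a = b]` for
non-diagonal pairs `a, b` (`Tr I = r`, `Tr(e_ie_jᵀ + e_je_iᵀ) = 0`, and the two `0/1` parts have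
`Tr = 2` common positions iff `a = b`, none otherwise). [cite: PrakashEtAl2017, §3.3.1 (p12)] -/
theorem trace_pairOneMatrix_mul {r : ℕ} {a b : Sym2 (Fin r)} (ha : ¬a.IsDiag) (hb : ¬b.IsDiag) :
    (pairOneMatrix r a * pairOneMatrix r b).trace = r + if a = b then 2 else 0 := by
  classical
  -- the off-diagonal `0/1` parts have zero trace
  have htr0 : ∀ c : Sym2 (Fin r), ¬c.IsDiag →
      (Matrix.of fun k l => if s(k, l) = c then (1 : ℂ) else 0).trace = 0 := by
    intro c hc
    simp only [trace, diag_apply, Matrix.of_apply]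
    refine Finset.sum_eq_zero fun k _ => ?_
    rw [if_neg]
    rintro rfl
    exact hc (Sym2.mk_isDiag_iff.mpr rfl)
  -- the product of the two `0/1` parts
  have hprod : (((Matrix.of fun k l => if s(k, l) = a then (1 : ℂ) else 0) *
      Matrix.of fun k l => if s(k, l) = b then (1 : ℂ) else 0)).trace = if a = b then 2 else 0 := by
    simp only [trace, diag_apply, Matrix.mul_apply, Matrix.of_apply]
    by_cases hab : a = b
    · subst hab
      rw [if_pos rfl]
      induction a using Sym2.ind with
      | h i j =>
        have hij : i ≠ j := by rwa [Sym2.mk_isDiag_iff] at ha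
        rw [← sum_sum_ite_mk_eq_mk hij]
        refine Finset.sum_congr rfl fun k _ => Finset.sum_congr rfl fun l _ => ?_
        rw [Sym2.eq_swap (a := l)]
        by_cases h : s(k, l) = s(i, j) <;> simp [h]
    · rw [if_neg hab]
      refine Finset.sum_eq_zero fun k _ => Finset.sum_eq_zero fun l _ => ?_
      rw [Sym2.eq_swap (a := l)]
      by_cases h : s(k, l) = a
      · rw [if_pos h, if_neg, mul_zero]
        rintro h'
        exact hab (h.symm.trans h')
      · rw [if_neg h, zero_mul]
  simp only [pairOneMatrix, add_mul, mul_add, one_mul, mul_one, trace_add, trace_one,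
    Fintype.card_fin, htr0 a ha, htr0 b hb, hprod, add_zero, zero_add]

/-- **The printed Gram matrix** `X = Gram({E_{i,j}}_{i<j})` in closed form: `X_{ab} = r + 2·[a = b]`,
i.e. `X = r·J + 2·I` of size `r(r−1)/2`. [cite: PrakashEtAl2017, §3.3.1 (p12)] -/
def pairGramMatrix (r : ℕ) : Matrix (OffDiagPair r) (OffDiagPair r) ℝ :=
  Matrix.of fun a b => (r : ℝ) + if a = b then 2 else 0

/-- `cpsd-rank(X) ≤ r` "by construction": the `E_a` form a `CS_+`-factorization of `X` of size `r`.
[cite: PrakashEtAl2017, §3.3.1 (p12)] -/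
theorem hasCpsdFactorization_pairGramMatrix (r : ℕ) : HasCpsdFactorization (pairGramMatrix r) r := by
  classical
  refine ⟨fun a => pairOneMatrix r a.1, fun a => pairOneMatrix_posSemidef_of_not_isDiag a.2,
    fun a b => ?_⟩
  rw [trace_pairOneMatrix_mul a.2 b.2, pairGramMatrix, Matrix.of_apply]
  by_cases hab : a = b
  · subst hab; simp
  · have hab' : a.1 ≠ b.1 := fun h => hab (Subtype.ext h)
    simp [hab, hab']

/-- `X = 2·I + r·𝟙𝟙ᵀ`. [cite: PrakashEtAl2017, §3.3.1 (p12)] -/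
theorem pairGramMatrix_eq (r : ℕ) :
    pairGramMatrix r = Matrix.diagonal (fun _ => (2 : ℝ)) +
      (r : ℝ) • vecMulVec (fun _ => (1 : ℝ)) (star fun _ => (1 : ℝ)) := by
  ext a b
  simp only [pairGramMatrix, Matrix.of_apply, Matrix.add_apply, diagonal_apply, Matrix.smul_apply,
    vecMulVec_apply, star_trivial, mul_one, smul_eq_mul]
  split_ifs <;> ring

/-- `X` is positive definite ("`X` can be easily seen to have full rank": `2I ≻ 0` plus `r·𝟙𝟙ᵀ ⪰ 0`).
[cite: PrakashEtAl2017, §3.3.1 (p12)] -/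
theorem pairGramMatrix_posDef (r : ℕ) : (pairGramMatrix r).PosDef := by
  classical
  rw [pairGramMatrix_eq]
  refine PosDef.add_posSemidef ?_ ((posSemidef_vecMulVec_self_star _).smul (Nat.cast_nonneg r))
  exact posDef_diagonal_iff.mpr fun _ => by norm_num

/-- **`X` has full rank** `r(r−1)/2`. [cite: PrakashEtAl2017, §3.3.1 (p12)] -/
theorem rank_pairGramMatrix (r : ℕ) : (pairGramMatrix r).rank = r.choose 2 := by
  classical
  rw [Matrix.rank_of_isUnit _ (pairGramMatrix_posDef r).isUnit, card_offDiagPair]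

/-- **PSVW §3.3.1 example** (p12): for every `r`, the `r(r−1)/2 × r(r−1)/2` matrix
`X = Gram({E_{i,j}}_{i<j}) = r·J + 2·I` satisfies `cpsd-rank(X) ≤ r` while `rank X = r(r−1)/2` — so
`√rank X ≤ cpsd-rank X` (`PrakashEtAl2017_rank_le_cpsdRank_sq`) is tight up to a constant factor.
[cite: PrakashEtAl2017, §3.3.1 (p12)] -/
theorem PrakashEtAl2017_rank_vs_cpsdRank_example (r : ℕ) :
    HasCpsdFactorization (pairGramMatrix r) r ∧ (pairGramMatrix r).rank = r.choose 2 ∧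
      Fintype.card (OffDiagPair r) = r.choose 2 :=
  ⟨hasCpsdFactorization_pairGramMatrix r, rank_pairGramMatrix r, card_offDiagPair r⟩

/-! ### §3.2.2: support-based lower bounds never exceed the size (`f(G) ≤ n`) -/

/-- **Feasibility of PSVW's support-based programme (8) at `d = n`** (p11: "By Lemma 5, the …
matrix `A − τI` … is cpsd. This shows that (8) is feasible"; we use instead the psd graph Laplacian
`L = D − A`, whose off-diagonal support is `G`): `X := L ∘ L` has off-diagonal support exactly `G`
(`X_{ij} = A_{ij}² = A_{ij}` for `i ≠ j`) and, by Lemma 5, a `CS_+`-factorization by rank-one factors of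
size `n`. [cite: PrakashEtAl2017, §3.2.2 (p11)] -/
theorem exists_support_eq_hasRankOneCpsdFactorization_card [DecidableEq ι] (G : SimpleGraph ι)
    [DecidableRel G.Adj] :
    ∃ X : Matrix ι ι ℝ, (∀ i j, i ≠ j → (X i j ≠ 0 ↔ G.Adj i j)) ∧
      HasRankOneCpsdFactorization X (Fintype.card ι) := by
  refine ⟨Matrix.of fun i j => (G.lapMatrix ℝ i j) ^ 2, fun i j hij => ?_,
    hasRankOneCpsdFactorization_of_sq_eq (G.posSemidef_lapMatrix ℝ) fun i j => rfl⟩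
  simp only [Matrix.of_apply, SimpleGraph.lapMatrix, SimpleGraph.degMatrix, Matrix.sub_apply,
    Matrix.diagonal_apply_ne _ hij, SimpleGraph.adjMatrix_apply, zero_sub, ne_eq]
  by_cases h : G.Adj i j <;> simp [h]

/-- Hence the minimum in Theorem 4 is at most `n`: some cpsd matrix with support graph `G` has
`cpsd-rank ≤ n`. [cite: PrakashEtAl2017, §3.2.2 (p11)] -/
theorem exists_support_eq_hasCpsdFactorization_card [DecidableEq ι] (G : SimpleGraph ι)
    [DecidableRel G.Adj] :
    ∃ X : Matrix ι ι ℝ, (∀ i j, i ≠ j → (X i j ≠ 0 ↔ G.Adj i j)) ∧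
      HasCpsdFactorization X (Fintype.card ι) := by
  obtain ⟨X, hX, h⟩ := exists_support_eq_hasRankOneCpsdFactorization_card G
  exact ⟨X, hX, h.hasCpsdFactorization⟩

/-- **`f(G) ≤ n`** (p11, verbatim: "By Theorem 4 and the fact that `f(G)` is upper bounded by `n` it
follows that support-based lower bounds on the cpsd-rank never exceed the size of the matrix"):
there are subspaces `L_1,…,L_n ⊆ ℂ^n` with `L_i ⊥ L_j ⟺ i ≁ j` (`i ≠ j`) — through the tree's
discharged Theorem 4 (`PrakashEtAl2017_thm4_holds`) applied to the matrix of the previous statement.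
[cite: PrakashEtAl2017, §3.2.2 (p11)] -/
theorem PrakashEtAl2017_supportBound_le_size {ι : Type} [Fintype ι] [DecidableEq ι]
    (G : SimpleGraph ι) [DecidableRel G.Adj] :
    ∃ L : ι → Submodule ℂ (EuclideanSpace ℂ (Fin (Fintype.card ι))),
      ∀ i j, i ≠ j → ((L i) ⟂ (L j) ↔ ¬ G.Adj i j) :=
  (PrakashEtAl2017_thm4_holds ι G (Fintype.card ι)).mp (exists_support_eq_hasCpsdFactorization_card G)

end Literature.Combinatorics.Optimization
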